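import Summits.QuantumFields.BalabanUV.Beta.D1BFx.TorusMixedLetters

/-!
# TB4-W PART 3b-N (FILE N3c) — the TERMS of the mixed straight weight jet as periodised bond arrays (road «BF-x», slot (K); ruling ρ-g7-8, (S1))

3a's `wgtMix b b′ = W₁ + ⋯ + W₉` (nine products in `Mjet•`, `Ĉ`, `Ĉ•`).  By `Ĉᵀ = Ĉ`, `Ĉₛᵀ = −Ĉₛ` (3a′) one has `W₁ = W₉ᵀ`, `W₂ = −W₈ᵀ`,
`W₃ = −W₇ᵀ`, `W₆ = W₅ᵀ`, so four words suffice: this file writes **`W₅`, `W₇` (hence `W₈` by `b ↔ b′`), `W₉` and `W₄`** at the torus bonds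
`b = (σu, κ)`, `b′ = (σu′, l)` as `(arr s K)^` for EXPLICIT s-dependent `ℤ⁴` bond kernels [our objects] `K5 K7 K9 K4` (shape (S1): one-array kernels,
two-array kernels `X ∘ A ∘ arr s Y`, the two-`Ê` table `eYe`, and the TORUS test `[(σu,κ) = (σu′,l)]` where `Ljet₁₁` enters).  `W₄` (site word `L̂ĈₛₜL̂`) is the companion file
`TorusWeightMixedTermW4`; the assembly `2•wgtMix = (arr (BwMix …))^`, (u1) and (u2) follow in N3d.
[folklore] matrix∕array algebra over landed letters (FILES N1–N3b); the kernel definitions assert nothing.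
-/

noncomputable section

namespace Summit.QuantumFields.BalabanUV.Beta.D1BFx.TorusWeightMixedTerms

open Matrix
open scoped BigOperators
open Literature.MathematicalPhysics.QuantumFieldTheory.Balaban1983to89
open Literature.MathematicalPhysics.QuantumFieldTheory.Balaban1983to89.Beta
open B12Sec2to5 (l1 l1_nonneg)
open ExpKernelCalculus (MKer BiLoc Decays Zl comp biLoc_comp_decays)
open AffineAveraging (unitVec)
open BalabanStepJetsSucc (biLoc_comp_right)
open Summit.QuantumFields.BalabanUV.Beta.TameKernelCalculus (Loc decays_of_le biLoc_of_le trK)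
open Summit.QuantumFields.BalabanUV.Beta.D1BFx.PeriodicArrays (arr toF decays_arr)
open Summit.QuantumFields.BalabanUV.Beta.D1BFx.FibredPeriodisation (periodiseF)
open Summit.QuantumFields.BalabanUV.Beta.D1BFx.GhostStencil (ghCur biLoc_ghCur)
open Summit.QuantumFields.BalabanUV.Beta.D1BFx.RJetProjector (Rgt decays_Rgt)
open Summit.QuantumFields.BalabanUV.Beta.D1BFx.RJetAssembly (dSw biLoc_dSw)
open Summit.QuantumFields.BalabanUV.Beta.D1BFx.PeriodisedProjector (Lhat Shat)
open Summit.QuantumFields.BalabanUV.Beta.D1BFx.TorusHodgeWeight (Dhat)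
open Summit.QuantumFields.BalabanUV.Beta.D1BFx.TorusGaugeWeight (Lhat_transpose)
open Summit.QuantumFields.BalabanUV.Beta.D1BFx.TorusCoframeJets (Djet Ljet Ljet₂ Ljet₁₁ Mjet₀ Mjet₁ Mjet₁₁ transpose_Ljet)
open Summit.QuantumFields.BalabanUV.Beta.D1BFx.TorusWeightJetsCombFree (Chat Cjet₁ Cjet₁₁ Lsq₁ Lsq₁₁ wgtMix)
open Summit.QuantumFields.BalabanUV.Beta.D1BFx.TorusJetSandwichArrays (jetR jetC biLoc_jetR biLoc_jetC)
open Summit.QuantumFields.BalabanUV.Beta.D1BFx.TorusGhostWordArrays (perT lapU decays_lapU Lgh biLoc_Lgh cL Ljet_eq_perT Lsq_word_eq_perT)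
open Summit.QuantumFields.BalabanUV.Beta.D1BFx.TorusGhostPairStencils (gh₂ biLoc_gh₂ biLoc_zero_of_nonneg)
open Summit.QuantumFields.BalabanUV.Beta.D1BFx.KGhostLeg (Cgh deltaCgh deltaCgh_pos decays_Cgh)
open Summit.QuantumFields.BalabanUV.Beta.D1BFx.KGhostLegJunction (Chat_eq_submatrix_periodiseF_Cgh)
open Summit.QuantumFields.BalabanUV.Beta.D1BFx.TorusBondArrays (hat_arr_add hat_arr_sub hat_arr_neg hat_arr_smul Dhat_mul_perT_arr_mul_Dhat_transpose dB dB_pos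
  dB_le_one dB_le_deltaCgh decays_lapU_Cgh decays_Cgh_lapU Lhat_Chat_Lhat_eq_perT perT_Cgh_mul_Lhat Lhat_mul_perT_Cgh)
open Summit.QuantumFields.BalabanUV.Beta.D1BFx.TorusWeightWordArrays (wL wR wC Ljet_Cgh_Lhat Lhat_Cgh_Ljet Lhat_Cgh_Lsq_Cgh_Lhat decays_Rgt_dB
  Djet_Rhat_Dhat_transpose Dhat_Rhat_Djet_transpose)
open Summit.QuantumFields.BalabanUV.Beta.D1BFx.TorusTwoArrayWords (biLoc_comp_arr eYe biLoc_eYe Djet_mul_perT_mul_Djet_transpose)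
open Summit.QuantumFields.BalabanUV.Beta.D1BFx.TorusMixedLetters (hat_arr_add_loc hat_arr_sub_loc hat_arr_zero hat_arr_ite transpose_hat_arr
  Djet_perT_arr_Dhat_transpose Dhat_perT_arr_Djet_transpose decays_Cgh_dB Ljet_Cgh_Ljet Lhat_Cgh_Ljet₁₁ Lhat_Cgh_Lsq_Cgh_Ljet
  Lhat_mul_perT_A₂ decays_A₃ decays_A₄ Lhat_perT_Cgh_Lhat W4_M1 W4_M2 W4_M4 W4_M5)

/-! ## §1 The kernels -/

section Kernels

variable (s : ℕ) [NeZero s] (n : ℕ) [NeZero n] (a : ℝ) (κ : Fin 4) (u : Fin 4 → ℤ) (l : Fin 4) (u' : Fin 4 → ℤ)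

/-- [our object] **K5 — the table of `W₅ = Mjetₛᵀ Ĉ Mjetₜ`**:
`−dSw (ghCur_β ∘ Cgh ∘ arr s ghCur_β′) + jetC l u′ (arr s wL_β) − jetR κ u (arr s wR_β′) + eYe s κ u l u′ Rgt`. A definition. -/
def K5 : MKer 4 (Fin 4) :=
  -dSw (comp (comp (ghCur κ u) (Cgh n a)) (arr s (ghCur l u'))) + jetC l u' (arr s (wL n a κ u))
    - jetR κ u (arr s (wR n a l u')) + eYe s κ u l u' (Rgt n a)

/-- [our object] **K7 — the table of `W₇ = M₀ᵀ Ĉₛ Mjetₜ`**: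
`−dSw ((((lapU∘Cgh) ∘ Lgh_β) ∘ Cgh) ∘ arr s ghCur_β′) + jetC l u′ (arr s wC_β)`. A definition. -/
def K7 : MKer 4 (Fin 4) :=
  -dSw (comp (comp (comp (comp lapU (Cgh n a)) (Lgh κ u)) (Cgh n a)) (arr s (ghCur l u'))) + jetC l u' (arr s (wC n a κ u))

/-- [our object] **K9 — the table of `W₉ = M₀ᵀ Ĉ Mjetₛₜ`** (with the TORUS test `[(σu,κ) = (σu′,l)]`):
`[test]·dSw ((lapU∘Cgh) ∘ gh₂_β) − jetC l u′ (arr s wR_β) − jetC κ u (arr s wR_β′) + [test]·jetC κ u Rgt`. A definition. -/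
def K9 : MKer 4 (Fin 4) :=
  (if (siteOf 4 s u, κ) = (siteOf 4 s u', l) then dSw (comp (comp lapU (Cgh n a)) (gh₂ κ u)) else 0)
    - jetC l u' (arr s (wR n a κ u)) - jetC κ u (arr s (wR n a l u'))
    + (if (siteOf 4 s u, κ) = (siteOf 4 s u', l) then jetC κ u (Rgt n a) else 0)

/-- [our object] **Z4 — the site table of `L̂ Ĉₛₜ L̂`** (legs `A₁ = lapU∘Cgh`, `A₂ = Cgh∘lapU`, `A₃ = lapU∘A₂`, `A₄ = A₁∘lapU`):
`−([test]·((A₁∘gh₂_β)∘A₃ + (A₄∘gh₂_β)∘A₂) + (wR_β ∘ arr s ghCur_β′)∘A₂ + (wR_β′ ∘ arr s ghCur_β)∘A₂) + M5(β,β′) + M5(β′,β)`. A definition. -/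
def Z4 : MKer 4 Unit :=
  -((if (siteOf 4 s u, κ) = (siteOf 4 s u', l) then
        comp (comp (comp lapU (Cgh n a)) (gh₂ κ u)) (comp lapU (comp (Cgh n a) lapU))
          + comp (comp (comp (comp lapU (Cgh n a)) lapU) (gh₂ κ u)) (comp (Cgh n a) lapU) else 0)
      + comp (comp (wR n a κ u) (arr s (ghCur l u'))) (comp (Cgh n a) lapU)
      + comp (comp (wR n a l u') (arr s (ghCur κ u))) (comp (Cgh n a) lapU))
    + comp (comp (comp (comp (comp lapU (Cgh n a)) (Lgh κ u)) (Cgh n a)) (arr s (Lgh l u'))) (comp (Cgh n a) lapU)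
    + comp (comp (comp (comp (comp lapU (Cgh n a)) (Lgh l u')) (Cgh n a)) (arr s (Lgh κ u))) (comp (Cgh n a) lapU)

/-- [our object] **K4 — the table of `W₄ = M₀ᵀ Ĉₛₜ M₀`**: `dSw Z4`. A definition. -/
def K4 : MKer 4 (Fin 4) := dSw (Z4 s n a κ u l u')

end Kernels

/-! ## §2 The four words as periodised arrays -/

section Words

variable (m : ℕ) {a : ℝ} (p : ℕ) [NeZero p] {ρ : Type*} [Fintype ρ] [DecidableEq ρ] (κ : Fin 4) (u : Fin 4 → ℤ) (l : Fin 4) (u' : Fin 4 → ℤ)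

/-- [folklore] Uniform localisation of `wR_β` at `(u, u)` (FILE N2's constant, every bond). -/
theorem biLoc_wR (ha : 0 < a) : ∃ C : ℝ, 0 ≤ C ∧ ∀ (κ : Fin 4) (u : Fin 4 → ℤ), BiLoc (wR (m + 1) a κ u) u u C (dB (m + 1) a / 4) := by
  obtain ⟨C, hC⟩ := decays_lapU_Cgh (m + 1) a ha
  have hd := dB_pos (m + 1) a ha
  exact ⟨_, mul_nonneg (mul_nonneg (Nat.cast_nonneg _) (mul_nonneg (hC.nonneg ()) (Real.exp_pos _).le)) (ExpKernelCalculus.Zl_pos (by linarith)).le,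
    fun κ u => biLoc_comp_decays hC (biLoc_ghCur κ u (dB (m + 1) a / 2)) (by linarith) (by linarith : dB (m + 1) a / 4 < dB (m + 1) a / 2)⟩

/-- [folklore] Uniform localisation of `wL_β` at `(u, u)`. -/
theorem biLoc_wL (ha : 0 < a) : ∃ C : ℝ, 0 ≤ C ∧ ∀ (κ : Fin 4) (u : Fin 4 → ℤ), BiLoc (wL (m + 1) a κ u) u u C (dB (m + 1) a / 4) := by
  obtain ⟨C, hC⟩ := decays_Cgh_lapU (m + 1) a ha
  have hd := dB_pos (m + 1) a ha
  exact ⟨_, mul_nonneg (mul_nonneg (Nat.cast_nonneg _) (mul_nonneg (Real.exp_pos _).le (hC.nonneg ()))) (ExpKernelCalculus.Zl_pos (by linarith)).le,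
    fun κ u => biLoc_comp_right (biLoc_ghCur κ u (dB (m + 1) a / 2)) hC (by linarith) (by linarith : dB (m + 1) a / 4 < dB (m + 1) a / 2)⟩

/-- [folklore] Uniform localisation of the two-array word `ghCur_β ∘ Cgh ∘ arr s ghCur_β′` at `(u, u)` (s-free constant). -/
theorem biLoc_cur_Cgh_arr_cur (ha : 0 < a) : ∃ C : ℝ, 0 ≤ C ∧ ∀ (s : ℕ) [NeZero s] (κ : Fin 4) (u : Fin 4 → ℤ) (l : Fin 4) (u' : Fin 4 → ℤ),
    BiLoc (comp (comp (ghCur κ u) (Cgh (m + 1) a)) (arr s (ghCur l u'))) u u C (dB (m + 1) a / 4 / 4) := by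
  obtain ⟨C, hC⟩ := decays_Cgh_dB m ha
  have hd := dB_pos (m + 1) a ha
  have hX : ∀ (κ : Fin 4) (u : Fin 4 → ℤ), BiLoc (comp (ghCur κ u) (Cgh (m + 1) a)) u u
      ((Fintype.card Unit : ℝ) * (Real.exp (dB (m + 1) a / 2) * C) * Zl 4 (dB (m + 1) a / 2 - dB (m + 1) a / 4)) (dB (m + 1) a / 4) :=
    fun κ u => biLoc_comp_right (biLoc_ghCur κ u (dB (m + 1) a / 2)) hC (by linarith) (by linarith)
  have h0 : 0 ≤ (Fintype.card Unit : ℝ) * (Real.exp (dB (m + 1) a / 2) * C) * Zl 4 (dB (m + 1) a / 2 - dB (m + 1) a / 4) :=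
    mul_nonneg (mul_nonneg (Nat.cast_nonneg _) (mul_nonneg (Real.exp_pos _).le (hC.nonneg ()))) (ExpKernelCalculus.Zl_pos (by linarith)).le
  refine ⟨(Fintype.card Unit : ℝ) * (((Fintype.card Unit : ℝ) * (Real.exp (dB (m + 1) a / 2) * C) * Zl 4 (dB (m + 1) a / 2 - dB (m + 1) a / 4))
      * (Real.exp (dB (m + 1) a / 4) * Zl 4 (dB (m + 1) a / 4 / 2))) * Zl 4 (dB (m + 1) a / 4 / 2 - dB (m + 1) a / 4 / 4), ?_, fun s _ κ u l u' => ?_⟩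
  · exact mul_nonneg (mul_nonneg (Nat.cast_nonneg _) (mul_nonneg h0 (mul_nonneg (Real.exp_pos _).le (ExpKernelCalculus.Zl_pos (by linarith)).le)))
      (ExpKernelCalculus.Zl_pos (by linarith)).le
  · have h := biLoc_comp_arr s (hX κ u) (biLoc_ghCur l u' (dB (m + 1) a / 4)) (by linarith)
    rw [sub_self, GhostStencil.l1_zero, mul_zero, Real.exp_zero, mul_one] at h
    exact h

/-- [folklore] **`W₅ = (arr K5)^`**: `(Mjet₁ b)ᵀ · Ĉ · Mjet₁ b′ = (arr s (K5 s (m+1) a κ u l u′))^` at `b = (σu,κ)`, `b′ = (σu′,l)`, every `s = (m+1)p`. -/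
theorem W5_eq_hat (ha : 0 < a) {N : Matrix (Site 4 ((m + 1) * p)) ρ ℝ}
    (hN : ∀ lam : Site 4 ((m + 1) * p) → ℝ, Shat m ((m + 1) * p) *ᵥ lam = 0 ↔ ∃ c : ρ → ℝ, lam = N *ᵥ c)
    (hNinj : Function.Injective N.mulVec) :
    (Mjet₁ ((m + 1) * p) (siteOf 4 ((m + 1) * p) u, κ))ᵀ * Chat ((m + 1) * p) N * Mjet₁ ((m + 1) * p) (siteOf 4 ((m + 1) * p) u', l) = Matrix.of (periodiseF ((m + 1) * p) (toF (arr ((m + 1) * p) (K5 ((m + 1) * p) (m + 1) a κ u l u')))) := by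
  have hd := dB_pos (m + 1) a ha
  obtain ⟨C₁, -, h₁⟩ := biLoc_cur_Cgh_arr_cur m ha
  obtain ⟨CL, -, hL⟩ := biLoc_wL m ha
  obtain ⟨CR, -, hR⟩ := biLoc_wR m ha
  have hCh : Chat ((m + 1) * p) N = perT ((m + 1) * p) (Cgh (m + 1) a) := Chat_eq_submatrix_periodiseF_Cgh m p ha hN hNinj
  have e1 : (Mjet₁ ((m + 1) * p) (siteOf 4 ((m + 1) * p) u, κ))ᵀ * Chat ((m + 1) * p) N * Mjet₁ ((m + 1) * p) (siteOf 4 ((m + 1) * p) u', l)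
      = -(Dhat 4 ((m + 1) * p) * (Ljet ((m + 1) * p) (siteOf 4 ((m + 1) * p) u, κ) * Chat ((m + 1) * p) N * Ljet ((m + 1) * p) (siteOf 4 ((m + 1) * p) u', l)) * (Dhat 4 ((m + 1) * p))ᵀ)
        + Dhat 4 ((m + 1) * p) * (Ljet ((m + 1) * p) (siteOf 4 ((m + 1) * p) u, κ) * (Chat ((m + 1) * p) N * Lhat ((m + 1) * p))) * (Djet ((m + 1) * p) (siteOf 4 ((m + 1) * p) u', l))ᵀ
        - Djet ((m + 1) * p) (siteOf 4 ((m + 1) * p) u, κ) * (Lhat ((m + 1) * p) * Chat ((m + 1) * p) N * Ljet ((m + 1) * p) (siteOf 4 ((m + 1) * p) u', l)) * (Dhat 4 ((m + 1) * p))ᵀ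
        + Djet ((m + 1) * p) (siteOf 4 ((m + 1) * p) u, κ) * (Lhat ((m + 1) * p) * Chat ((m + 1) * p) N * Lhat ((m + 1) * p)) * (Djet ((m + 1) * p) (siteOf 4 ((m + 1) * p) u', l))ᵀ := by
    simp only [Mjet₁, Matrix.transpose_sub, Matrix.transpose_mul, Matrix.transpose_transpose, transpose_Ljet, Lhat_transpose,
      Matrix.sub_mul, Matrix.mul_sub, Matrix.neg_mul, Matrix.mul_neg, Matrix.mul_assoc]
    abel
  -- localisation of the four pieces (for TA2 linearity)
  have L1 : Loc (dSw (comp (comp (ghCur κ u) (Cgh (m + 1) a)) (arr ((m + 1) * p) (ghCur l u')))) :=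
    ⟨u, u, _, dB (m + 1) a / 4 / 4, by linarith, biLoc_dSw u _ (by linarith) (h₁ ((m + 1) * p) κ u l u')⟩
  have L2 : Loc (jetC l u' (arr ((m + 1) * p) (wL (m + 1) a κ u))) :=
    ⟨u', u', _, dB (m + 1) a / 4 / 2, by linarith, biLoc_jetC l u' (hδ := by linarith) (hY := decays_arr (hL κ u) (by linarith) ((m + 1) * p))⟩
  have L3 : Loc (jetR κ u (arr ((m + 1) * p) (wR (m + 1) a l u'))) :=
    ⟨u, u, _, dB (m + 1) a / 4 / 2, by linarith, biLoc_jetR κ u (hδ := by linarith) (hY := decays_arr (hR l u') (by linarith) ((m + 1) * p))⟩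
  have L4 : Loc (eYe ((m + 1) * p) κ u l u' (Rgt (m + 1) a)) := ⟨_, _, _, _, one_pos, biLoc_eYe ((m + 1) * p) κ u l u' (Rgt (m + 1) a) 1⟩
  rw [e1, Lhat_Chat_Lhat_eq_perT a m p ha hN hNinj, Djet_mul_perT_mul_Djet_transpose ((m + 1) * p) κ u l u' (Rgt (m + 1) a), hCh,
    Ljet_Cgh_Ljet m p κ u l u' ha, Ljet_Cgh_Lhat m p κ u ha, Lhat_Cgh_Ljet m p l u' ha,
    Dhat_mul_perT_arr_mul_Dhat_transpose _ (h₁ ((m + 1) * p) κ u l u') (by linarith),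
    Dhat_perT_arr_Djet_transpose _ l u' (hL κ u) (by linarith), Djet_perT_arr_Dhat_transpose _ κ u (hR l u') (by linarith), K5,
    hat_arr_add_loc _ ((L1.neg.add L2).sub L3) L4, hat_arr_sub_loc _ (L1.neg.add L2) L3, hat_arr_add_loc _ L1.neg L2, hat_arr_neg]

/-- [folklore] Uniform localisation of `wC_β` at `(u, u)` (rate `dB/8`). -/
theorem biLoc_wC (ha : 0 < a) : ∃ C : ℝ, 0 ≤ C ∧ ∀ (κ : Fin 4) (u : Fin 4 → ℤ), BiLoc (wC (m + 1) a κ u) u u C (dB (m + 1) a / 8) := by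
  obtain ⟨C₂, hC₂⟩ := decays_Cgh_lapU (m + 1) a ha
  obtain ⟨C₃, h3, hC₃⟩ := TorusWeightWordArrays.biLoc_lapU_Cgh_Lgh m ha
  have hd := dB_pos (m + 1) a ha
  have hC₂' : Decays (comp (Cgh (m + 1) a) lapU) (|C₂|) (dB (m + 1) a / 4) := decays_of_le hC₂ (by linarith)
  exact ⟨_, mul_nonneg (mul_nonneg (Nat.cast_nonneg _) (mul_nonneg h3 (abs_nonneg _))) (ExpKernelCalculus.Zl_pos (by linarith)).le,
    fun κ u => biLoc_comp_right (hC₃ κ u) hC₂' (by linarith) (by linarith : dB (m + 1) a / 8 < dB (m + 1) a / 4)⟩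

/-- [folklore] Uniform localisation of the two-array word `(((lapU∘Cgh)∘Lgh_β)∘Cgh) ∘ arr s ghCur_β′` at `(u, u)` (s-free constant). -/
theorem biLoc_Z5 (ha : 0 < a) : ∃ C : ℝ, 0 ≤ C ∧ ∀ (s : ℕ) [NeZero s] (κ : Fin 4) (u : Fin 4 → ℤ) (l : Fin 4) (u' : Fin 4 → ℤ),
    BiLoc (comp (comp (comp (comp lapU (Cgh (m + 1) a)) (Lgh κ u)) (Cgh (m + 1) a)) (arr s (ghCur l u'))) u u C (dB (m + 1) a / 8 / 4) := by
  obtain ⟨C, hC⟩ := decays_Cgh_dB m ha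
  obtain ⟨C₃, h3, hC₃⟩ := TorusWeightWordArrays.biLoc_lapU_Cgh_Lgh m ha
  have hd := dB_pos (m + 1) a ha
  have hX : ∀ (κ : Fin 4) (u : Fin 4 → ℤ), BiLoc (comp (comp (comp lapU (Cgh (m + 1) a)) (Lgh κ u)) (Cgh (m + 1) a)) u u
      ((Fintype.card Unit : ℝ) * (C₃ * |C|) * Zl 4 (dB (m + 1) a / 4 - dB (m + 1) a / 8)) (dB (m + 1) a / 8) :=
    fun κ u => biLoc_comp_right (hC₃ κ u) (decays_of_le hC (by linarith)) (by linarith) (by linarith)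
  have h0 : 0 ≤ (Fintype.card Unit : ℝ) * (C₃ * |C|) * Zl 4 (dB (m + 1) a / 4 - dB (m + 1) a / 8) :=
    mul_nonneg (mul_nonneg (Nat.cast_nonneg _) (mul_nonneg h3 (abs_nonneg _))) (ExpKernelCalculus.Zl_pos (by linarith)).le
  refine ⟨(Fintype.card Unit : ℝ) * (((Fintype.card Unit : ℝ) * (C₃ * |C|) * Zl 4 (dB (m + 1) a / 4 - dB (m + 1) a / 8))
      * (Real.exp (dB (m + 1) a / 8) * Zl 4 (dB (m + 1) a / 8 / 2))) * Zl 4 (dB (m + 1) a / 8 / 2 - dB (m + 1) a / 8 / 4), ?_,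
      fun s _ κ u l u' => ?_⟩
  · exact mul_nonneg (mul_nonneg (Nat.cast_nonneg _) (mul_nonneg h0 (mul_nonneg (Real.exp_pos _).le (ExpKernelCalculus.Zl_pos (by linarith)).le)))
      (ExpKernelCalculus.Zl_pos (by linarith)).le
  · have h := biLoc_comp_arr s (hX κ u) (biLoc_ghCur l u' (dB (m + 1) a / 8)) (by linarith)
    rw [sub_self, GhostStencil.l1_zero, mul_zero, Real.exp_zero, mul_one] at h
    exact h

/-- [folklore] **`W₇ = (arr K7)^`**: `M₀ᵀ · Ĉₛ · Mjet₁ b′ = (arr s (K7 s (m+1) a κ u l u′))^`. -/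
theorem W7_eq_hat (ha : 0 < a) {N : Matrix (Site 4 ((m + 1) * p)) ρ ℝ}
    (hN : ∀ lam : Site 4 ((m + 1) * p) → ℝ, Shat m ((m + 1) * p) *ᵥ lam = 0 ↔ ∃ c : ρ → ℝ, lam = N *ᵥ c)
    (hNinj : Function.Injective N.mulVec) :
    (Mjet₀ ((m + 1) * p))ᵀ * Cjet₁ ((m + 1) * p) (siteOf 4 ((m + 1) * p) u, κ) N * Mjet₁ ((m + 1) * p) (siteOf 4 ((m + 1) * p) u', l) = Matrix.of (periodiseF ((m + 1) * p) (toF (arr ((m + 1) * p) (K7 ((m + 1) * p) (m + 1) a κ u l u')))) := by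
  have hd := dB_pos (m + 1) a ha
  obtain ⟨C₅, -, h₅⟩ := biLoc_Z5 m ha
  obtain ⟨CW, -, hW⟩ := biLoc_wC m ha
  have hCh : Chat ((m + 1) * p) N = perT ((m + 1) * p) (Cgh (m + 1) a) := Chat_eq_submatrix_periodiseF_Cgh m p ha hN hNinj
  have e1 : (Mjet₀ ((m + 1) * p))ᵀ * Cjet₁ ((m + 1) * p) (siteOf 4 ((m + 1) * p) u, κ) N * Mjet₁ ((m + 1) * p) (siteOf 4 ((m + 1) * p) u', l)
      = -(Dhat 4 ((m + 1) * p) * (Lhat ((m + 1) * p) * Chat ((m + 1) * p) N * Lsq₁ ((m + 1) * p) (siteOf 4 ((m + 1) * p) u, κ) * Chat ((m + 1) * p) N * Ljet ((m + 1) * p) (siteOf 4 ((m + 1) * p) u', l)) * (Dhat 4 ((m + 1) * p))ᵀ)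
        + Dhat 4 ((m + 1) * p) * (Lhat ((m + 1) * p) * Chat ((m + 1) * p) N * Lsq₁ ((m + 1) * p) (siteOf 4 ((m + 1) * p) u, κ) * (Chat ((m + 1) * p) N * Lhat ((m + 1) * p))) * (Djet ((m + 1) * p) (siteOf 4 ((m + 1) * p) u', l))ᵀ := by
    simp only [Mjet₀, Mjet₁, Cjet₁, Matrix.transpose_mul, Matrix.transpose_transpose, Lhat_transpose,
      Matrix.mul_sub, Matrix.neg_mul, Matrix.mul_neg, Matrix.mul_assoc]
    abel
  have L1 : Loc (dSw (comp (comp (comp (comp lapU (Cgh (m + 1) a)) (Lgh κ u)) (Cgh (m + 1) a)) (arr ((m + 1) * p) (ghCur l u')))) :=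
    ⟨u, u, _, dB (m + 1) a / 8 / 4, by linarith, biLoc_dSw u _ (by linarith) (h₅ ((m + 1) * p) κ u l u')⟩
  have L2 : Loc (jetC l u' (arr ((m + 1) * p) (wC (m + 1) a κ u))) :=
    ⟨u', u', _, dB (m + 1) a / 8 / 2, by linarith, biLoc_jetC l u' (hδ := by linarith) (hY := decays_arr (hW κ u) (by linarith) ((m + 1) * p))⟩
  rw [e1, hCh, Lsq₁, Lhat_Cgh_Lsq_Cgh_Ljet m p κ u l u' ha, Lhat_Cgh_Lsq_Cgh_Lhat m p κ u ha,
    Dhat_mul_perT_arr_mul_Dhat_transpose _ (h₅ ((m + 1) * p) κ u l u') (by linarith),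
    Dhat_perT_arr_Djet_transpose _ l u' (hW κ u) (by linarith), K7, hat_arr_add_loc _ L1.neg L2, hat_arr_neg]

/-- [folklore] The zero bond kernel is localised anywhere. -/
theorem biLoc_zero_bond (p'' q'' : Fin 4 → ℤ) (δ : ℝ) : BiLoc (0 : MKer 4 (Fin 4)) p'' q'' 0 δ := fun x y a b => by simp

/-- [folklore] **`W₉ = (arr K9)^`**: `M₀ᵀ · Ĉ · Mjet₁₁ b b′ = (arr s (K9 s (m+1) a κ u l u′))^` (the torus test `b = b′` carried inside `K9`). -/
theorem W9_eq_hat (ha : 0 < a) {N : Matrix (Site 4 ((m + 1) * p)) ρ ℝ}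
    (hN : ∀ lam : Site 4 ((m + 1) * p) → ℝ, Shat m ((m + 1) * p) *ᵥ lam = 0 ↔ ∃ c : ρ → ℝ, lam = N *ᵥ c)
    (hNinj : Function.Injective N.mulVec) :
    (Mjet₀ ((m + 1) * p))ᵀ * Chat ((m + 1) * p) N * Mjet₁₁ ((m + 1) * p) (siteOf 4 ((m + 1) * p) u, κ) (siteOf 4 ((m + 1) * p) u', l) = Matrix.of (periodiseF ((m + 1) * p) (toF (arr ((m + 1) * p) (K9 ((m + 1) * p) (m + 1) a κ u l u')))) := by
  have hd := dB_pos (m + 1) a ha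
  obtain ⟨C₁, hC₁⟩ := decays_lapU_Cgh (m + 1) a ha
  obtain ⟨CR, -, hR⟩ := biLoc_wR m ha
  have hCh : Chat ((m + 1) * p) N = perT ((m + 1) * p) (Cgh (m + 1) a) := Chat_eq_submatrix_periodiseF_Cgh m p ha hN hNinj
  have hA : BiLoc (comp (comp lapU (Cgh (m + 1) a)) (gh₂ κ u)) u u _ (dB (m + 1) a / 4) :=
    biLoc_comp_decays hC₁ (biLoc_gh₂ κ u (dB (m + 1) a / 2)) (by linarith) (by linarith)
  have L1 : Loc (if (siteOf 4 ((m + 1) * p) u, κ) = (siteOf 4 ((m + 1) * p) u', l) then dSw (comp (comp lapU (Cgh (m + 1) a)) (gh₂ κ u)) else 0) := by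
    split_ifs
    · exact ⟨u, u, _, dB (m + 1) a / 4, by linarith, biLoc_dSw u _ (by linarith) hA⟩
    · exact ⟨u, u, 0, 1, one_pos, biLoc_zero_bond u u 1⟩
  have L2 : Loc (jetC l u' (arr ((m + 1) * p) (wR (m + 1) a κ u))) :=
    ⟨u', u', _, dB (m + 1) a / 4 / 2, by linarith, biLoc_jetC l u' (hδ := by linarith) (hY := decays_arr (hR κ u) (by linarith) ((m + 1) * p))⟩
  have L3 : Loc (jetC κ u (arr ((m + 1) * p) (wR (m + 1) a l u'))) :=
    ⟨u, u, _, dB (m + 1) a / 4 / 2, by linarith, biLoc_jetC κ u (hδ := by linarith) (hY := decays_arr (hR l u') (by linarith) ((m + 1) * p))⟩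
  have L4 : Loc (if (siteOf 4 ((m + 1) * p) u, κ) = (siteOf 4 ((m + 1) * p) u', l) then jetC κ u (Rgt (m + 1) a) else 0) := by
    split_ifs
    · exact ⟨u, u, _, dB (m + 1) a / 8, by linarith, biLoc_jetC κ u (hδ := by linarith) (hY := decays_Rgt_dB m ha)⟩
    · exact ⟨u, u, 0, 1, one_pos, biLoc_zero_bond u u 1⟩
  have hrhs : Matrix.of (periodiseF ((m + 1) * p) (toF (arr ((m + 1) * p) (K9 ((m + 1) * p) (m + 1) a κ u l u'))))
      = (if (siteOf 4 ((m + 1) * p) u, κ) = (siteOf 4 ((m + 1) * p) u', l) then Matrix.of (periodiseF ((m + 1) * p) (toF (arr ((m + 1) * p) (dSw (comp (comp lapU (Cgh (m + 1) a)) (gh₂ κ u)))))) else 0)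
        - Matrix.of (periodiseF ((m + 1) * p) (toF (arr ((m + 1) * p) (jetC l u' (arr ((m + 1) * p) (wR (m + 1) a κ u))))))
        - Matrix.of (periodiseF ((m + 1) * p) (toF (arr ((m + 1) * p) (jetC κ u (arr ((m + 1) * p) (wR (m + 1) a l u'))))))
        + (if (siteOf 4 ((m + 1) * p) u, κ) = (siteOf 4 ((m + 1) * p) u', l) then Matrix.of (periodiseF ((m + 1) * p) (toF (arr ((m + 1) * p) (jetC κ u (Rgt (m + 1) a))))) else 0) := by
    rw [K9, hat_arr_add_loc _ ((L1.sub L2).sub L3) L4, hat_arr_sub_loc _ (L1.sub L2) L3, hat_arr_sub_loc _ L1 L2, hat_arr_ite, hat_arr_ite]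
  rw [hrhs]
  by_cases ht : (siteOf 4 ((m + 1) * p) u, κ) = (siteOf 4 ((m + 1) * p) u', l)
  · have e1 : (Mjet₀ ((m + 1) * p))ᵀ * Chat ((m + 1) * p) N * Mjet₁₁ ((m + 1) * p) (siteOf 4 ((m + 1) * p) u, κ) (siteOf 4 ((m + 1) * p) u', l)
        = Dhat 4 ((m + 1) * p) * (Lhat ((m + 1) * p) * Chat ((m + 1) * p) N * Ljet₁₁ ((m + 1) * p) (siteOf 4 ((m + 1) * p) u, κ) (siteOf 4 ((m + 1) * p) u', l)) * (Dhat 4 ((m + 1) * p))ᵀ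
          - Dhat 4 ((m + 1) * p) * (Lhat ((m + 1) * p) * Chat ((m + 1) * p) N * Ljet ((m + 1) * p) (siteOf 4 ((m + 1) * p) u, κ)) * (Djet ((m + 1) * p) (siteOf 4 ((m + 1) * p) u', l))ᵀ
          - Dhat 4 ((m + 1) * p) * (Lhat ((m + 1) * p) * Chat ((m + 1) * p) N * Ljet ((m + 1) * p) (siteOf 4 ((m + 1) * p) u', l)) * (Djet ((m + 1) * p) (siteOf 4 ((m + 1) * p) u, κ))ᵀ
          + Dhat 4 ((m + 1) * p) * (Lhat ((m + 1) * p) * Chat ((m + 1) * p) N * Lhat ((m + 1) * p)) * (Djet ((m + 1) * p) (siteOf 4 ((m + 1) * p) u, κ))ᵀ := by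
      rw [Mjet₁₁, if_pos ht]
      simp only [Mjet₀, Matrix.transpose_mul, Matrix.transpose_transpose, Lhat_transpose, Matrix.mul_sub, Matrix.mul_add, Matrix.mul_assoc]
      abel
    rw [e1, Dhat_Rhat_Djet_transpose m p κ u ha hN hNinj, hCh, Lhat_Cgh_Ljet₁₁ m p κ u l u' ha, Lhat_Cgh_Ljet m p κ u ha,
      Lhat_Cgh_Ljet m p l u' ha, Dhat_perT_arr_Djet_transpose _ l u' (hR κ u) (by linarith),
      Dhat_perT_arr_Djet_transpose _ κ u (hR l u') (by linarith)]
    simp only [if_pos ht]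
    rw [Dhat_mul_perT_arr_mul_Dhat_transpose _ hA (by linarith)]
  · have e1 : (Mjet₀ ((m + 1) * p))ᵀ * Chat ((m + 1) * p) N * Mjet₁₁ ((m + 1) * p) (siteOf 4 ((m + 1) * p) u, κ) (siteOf 4 ((m + 1) * p) u', l)
        = Dhat 4 ((m + 1) * p) * (Lhat ((m + 1) * p) * Chat ((m + 1) * p) N * Ljet₁₁ ((m + 1) * p) (siteOf 4 ((m + 1) * p) u, κ) (siteOf 4 ((m + 1) * p) u', l)) * (Dhat 4 ((m + 1) * p))ᵀ
          - Dhat 4 ((m + 1) * p) * (Lhat ((m + 1) * p) * Chat ((m + 1) * p) N * Ljet ((m + 1) * p) (siteOf 4 ((m + 1) * p) u, κ)) * (Djet ((m + 1) * p) (siteOf 4 ((m + 1) * p) u', l))ᵀ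
          - Dhat 4 ((m + 1) * p) * (Lhat ((m + 1) * p) * Chat ((m + 1) * p) N * Ljet ((m + 1) * p) (siteOf 4 ((m + 1) * p) u', l)) * (Djet ((m + 1) * p) (siteOf 4 ((m + 1) * p) u, κ))ᵀ := by
      rw [Mjet₁₁, if_neg ht]
      simp only [Mjet₀, Matrix.transpose_mul, Matrix.transpose_transpose, Lhat_transpose, Matrix.mul_sub, Matrix.mul_add, Matrix.mul_assoc,
        add_zero]
      abel
    rw [e1, hCh, Lhat_Cgh_Ljet₁₁ m p κ u l u' ha, Lhat_Cgh_Ljet m p κ u ha, Lhat_Cgh_Ljet m p l u' ha,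
      Dhat_perT_arr_Djet_transpose _ l u' (hR κ u) (by linarith), Dhat_perT_arr_Djet_transpose _ κ u (hR l u') (by linarith)]
    simp only [if_neg ht, Matrix.mul_zero, Matrix.zero_mul, zero_sub, add_zero]

/-- [folklore] `K5` is localised (every `s`). -/
theorem loc_K5 (ha : 0 < a) : Loc (K5 ((m + 1) * p) (m + 1) a κ u l u') := by
  have hd := dB_pos (m + 1) a ha
  obtain ⟨C₁, -, h₁⟩ := biLoc_cur_Cgh_arr_cur m ha
  obtain ⟨CL, -, hL⟩ := biLoc_wL m ha
  obtain ⟨CR, -, hR⟩ := biLoc_wR m ha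
  have L1 : Loc (dSw (comp (comp (ghCur κ u) (Cgh (m + 1) a)) (arr ((m + 1) * p) (ghCur l u')))) :=
    ⟨u, u, _, dB (m + 1) a / 4 / 4, by linarith, biLoc_dSw u _ (by linarith) (h₁ ((m + 1) * p) κ u l u')⟩
  have L2 : Loc (jetC l u' (arr ((m + 1) * p) (wL (m + 1) a κ u))) :=
    ⟨u', u', _, dB (m + 1) a / 4 / 2, by linarith, biLoc_jetC l u' (hδ := by linarith) (hY := decays_arr (hL κ u) (by linarith) ((m + 1) * p))⟩
  have L3 : Loc (jetR κ u (arr ((m + 1) * p) (wR (m + 1) a l u'))) :=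
    ⟨u, u, _, dB (m + 1) a / 4 / 2, by linarith, biLoc_jetR κ u (hδ := by linarith) (hY := decays_arr (hR l u') (by linarith) ((m + 1) * p))⟩
  have L4 : Loc (eYe ((m + 1) * p) κ u l u' (Rgt (m + 1) a)) := ⟨_, _, _, _, one_pos, biLoc_eYe ((m + 1) * p) κ u l u' (Rgt (m + 1) a) 1⟩
  exact ((L1.neg.add L2).sub L3).add L4

/-- [folklore] `K7` is localised (every `s`). -/
theorem loc_K7 (ha : 0 < a) : Loc (K7 ((m + 1) * p) (m + 1) a κ u l u') := by
  have hd := dB_pos (m + 1) a ha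
  obtain ⟨C₅, -, h₅⟩ := biLoc_Z5 m ha
  obtain ⟨CW, -, hW⟩ := biLoc_wC m ha
  have L1 : Loc (dSw (comp (comp (comp (comp lapU (Cgh (m + 1) a)) (Lgh κ u)) (Cgh (m + 1) a)) (arr ((m + 1) * p) (ghCur l u')))) :=
    ⟨u, u, _, dB (m + 1) a / 8 / 4, by linarith, biLoc_dSw u _ (by linarith) (h₅ ((m + 1) * p) κ u l u')⟩
  have L2 : Loc (jetC l u' (arr ((m + 1) * p) (wC (m + 1) a κ u))) :=
    ⟨u', u', _, dB (m + 1) a / 8 / 2, by linarith, biLoc_jetC l u' (hδ := by linarith) (hY := decays_arr (hW κ u) (by linarith) ((m + 1) * p))⟩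
  exact L1.neg.add L2

/-- [folklore] `K9` is localised (every `s`). -/
theorem loc_K9 (ha : 0 < a) : Loc (K9 ((m + 1) * p) (m + 1) a κ u l u') := by
  have hd := dB_pos (m + 1) a ha
  obtain ⟨C₁, hC₁⟩ := decays_lapU_Cgh (m + 1) a ha
  obtain ⟨CR, -, hR⟩ := biLoc_wR m ha
  have hA : BiLoc (comp (comp lapU (Cgh (m + 1) a)) (gh₂ κ u)) u u _ (dB (m + 1) a / 4) :=
    biLoc_comp_decays hC₁ (biLoc_gh₂ κ u (dB (m + 1) a / 2)) (by linarith) (by linarith)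
  have L1 : Loc (if (siteOf 4 ((m + 1) * p) u, κ) = (siteOf 4 ((m + 1) * p) u', l) then dSw (comp (comp lapU (Cgh (m + 1) a)) (gh₂ κ u)) else 0) := by
    split_ifs
    · exact ⟨u, u, _, dB (m + 1) a / 4, by linarith, biLoc_dSw u _ (by linarith) hA⟩
    · exact ⟨u, u, 0, 1, one_pos, biLoc_zero_bond u u 1⟩
  have L2 : Loc (jetC l u' (arr ((m + 1) * p) (wR (m + 1) a κ u))) :=
    ⟨u', u', _, dB (m + 1) a / 4 / 2, by linarith, biLoc_jetC l u' (hδ := by linarith) (hY := decays_arr (hR κ u) (by linarith) ((m + 1) * p))⟩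
  have L3 : Loc (jetC κ u (arr ((m + 1) * p) (wR (m + 1) a l u'))) :=
    ⟨u, u, _, dB (m + 1) a / 4 / 2, by linarith, biLoc_jetC κ u (hδ := by linarith) (hY := decays_arr (hR l u') (by linarith) ((m + 1) * p))⟩
  have L4 : Loc (if (siteOf 4 ((m + 1) * p) u, κ) = (siteOf 4 ((m + 1) * p) u', l) then jetC κ u (Rgt (m + 1) a) else 0) := by
    split_ifs
    · exact ⟨u, u, _, dB (m + 1) a / 8, by linarith, biLoc_jetC κ u (hδ := by linarith) (hY := decays_Rgt_dB m ha)⟩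
    · exact ⟨u, u, 0, 1, one_pos, biLoc_zero_bond u u 1⟩
  exact ((L1.sub L2).sub L3).add L4

end Words



end Summit.QuantumFields.BalabanUV.Beta.D1BFx.TorusWeightMixedTerms

end
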